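import Summits.CriticalPhenomena.Ising3D.TaylorTableCertB3OddHeadRows56P1
import Summits.CriticalPhenomena.Ising3D.TaylorTableCertB3OddHeadRows56P2
import Summits.CriticalPhenomena.Ising3D.TaylorTableCertB3OddHeadRows56P3
import Summits.CriticalPhenomena.Ising3D.TaylorTableCertB3OddHeadRows56P4
import HarnessLib

/-!
# BOX B3: the ODD head files' ROW OBJECT at J = 56 as a tree data module (R19-σ seam support) — AGGREGATOR over 4 part modules (TaylorTableCertB3OddHeadRows56P1, TaylorTableCertB3OddHeadRows56P2, TaylorTableCertB3OddHeadRows56P3, TaylorTableCertB3OddHeadRows56P4)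
(cell `pub-ising3x`, boot-1 gen 20; generated by code/headdelta/versions/gen-L-staged/rows_module_emit.py; LEAD RULING R27-δ (B) 2026-08-24T22:05:18Z)

HONEST FRAMING: lottery ticket; floor = tightest certified 3D Ising CFT bounds; no exact-solution
claim without a proof. Island framing: certified exclusion region at stated derivative order and
assumptions; not a determination of the 3D Ising critical exponents beyond that.

The R19-σ row-object seam of a γ-box states `R.ValidΔ …` for the head files' LITERAL row object `R = ⟨2^64, J, σ0, Wσ, ε0, Wε, [L_0, …, L_(J-1)]⟩`. For BOX B3's
odd sector at J = 56 the 56 row literals alone are ≈ 620 KB — above the single-request caps of the seat farm check and of the gate socket — so they are landed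
as pure definitions (nothing is proved in these files) in 4 part modules + this aggregator, and the seam imports them: `CertB3.hoL_j` (j < 56) are written by exactly the head
emitters' code and are BYTE-IDENTICAL (text after `:=`) to every BOX B3 odd head file's non-blank `def L_j` (replay root pub-ising3x-boot-1/replay/B3;
checked at generation against a kept head file per row (55/56 rows have one) and, by normalised sha16, against the rows-of-record rows_B3_65536_J56odd.json
= the REPLAY.jsonl `rows_fp` of every file); `CertB3.headRowsLO56` lists them and `CertB3.headRowsO56` is the row object with the head files' scalars
(σ0 ((67915 : ℚ) / 131072), Wσ ((1 : ℚ) / 131072), ε0 ((182715 : ℚ) / 131072), Wε ((1 : ℚ) / 131072); = the `def R` line of the J = 56 head files). Readers re-check the identity ((σ1′): sigma1_check.py). No mathematics. [folklore]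
-/

set_option linter.style.longLine false

namespace Summit.CriticalPhenomena.Ising3D
namespace CertB3
open Literature.Analysis.ValidatedNumerics Literature.Analysis.ValidatedNumerics.PolyMP
open Literature.Analysis.ValidatedNumerics.NumericsMP (MI)
open Literature.MathematicalPhysics.QuantumFieldTheory.ConformalBootstrap3D

/-- the J = 56 odd head row list. [folklore] -/
def headRowsLO56 : List (OddLit) := [hoL0, hoL1, hoL2, hoL3, hoL4, hoL5, hoL6, hoL7, hoL8, hoL9, hoL10, hoL11, hoL12, hoL13, hoL14, hoL15, hoL16, hoL17, hoL18, hoL19, hoL20, hoL21, hoL22, hoL23, hoL24, hoL25, hoL26, hoL27, hoL28, hoL29, hoL30, hoL31, hoL32, hoL33, hoL34, hoL35, hoL36, hoL37, hoL38, hoL39, hoL40, hoL41, hoL42, hoL43, hoL44, hoL45, hoL46, hoL47, hoL48, hoL49, hoL50, hoL51, hoL52, hoL53, hoL54, hoL55]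

/-- the odd head files' row object at J = 56 (scalars = the head files' `def R`). [folklore] -/
def headRowsO56 : OddHeadRowsΔ := ⟨18446744073709551616, 56, ((67915 : ℚ) / 131072), ((1 : ℚ) / 131072), ((182715 : ℚ) / 131072), ((1 : ℚ) / 131072), headRowsLO56⟩

end CertB3
end Summit.CriticalPhenomena.Ising3D
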